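import Mathlib
import HarnessLib
import Summits.Parity.Statement
import Summits.Parity.BatemanHorn.Theses.OddParityLadder

/-!
# Assembly of route-Parity-OddParityLadder (item stmt-Parity-28278)

`Assembly : LinearCell → UpperNonlinear → ChenQuad → ChenRest → OddRough → OddGlue → BatemanHorn` is literally the route's certified deciding theorem `closes`
(node B1.1.1 «OddParityLadder» (decomp-parity lens-1 g3; beneath ChenQuad ∧ ChenRest at B1.1's residual ParityLift)): Chen-type almost-prime lower bounds + the one-sided odd-Liouville-sector bound + the parity glue give LowerNonlinear, then BH as in B1.  One line; no mathematics beyond the route file.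
-/

namespace Summit.Parity.BatemanHorn.Theses.OddParityLadder

/-- Assembly item stmt-Parity-28278 of route-Parity-OddParityLadder:
`LinearCell → UpperNonlinear → ChenQuad → ChenRest → OddRough → OddGlue → BatemanHorn`,
by the route's deciding theorem `closes`. -/
theorem assembly_proof : Assembly :=
  fun h1 h2 h3 h4 h5 h6 => closes h1 h2 h3 h4 h5 h6

end Summit.Parity.BatemanHorn.Theses.OddParityLadder
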